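import Summits.CriticalPhenomena.SAWScalingLimit.Theses.SAWTrackTransport
import Literature.Probability.RandomPlanarGeometry.YangBaxterSAWCylinder

/-!
# Line `cylinder-harvest` — an alternative registered skeleton for the crux `AngleUniversality`
(stmt-CriticalPhenomena-16963; rank 2 of `route-CriticalPhenomena-SAWTrackTransport`)

Crux (FIXED): `AngleUniversality := ∀ α ∈ [π/3, 2π/3], ∀ P chordal, RL(π/2) P → RL(α) P`
(`RobustLimit` below is the crux's `let RL` verbatim; `angleUniversality_iff` is `Iff.rfl`).

## The technique with teeth: HARVEST INTEGRABILITY ON THE CYLINDER (DKKMO §2.4 at `n = 0`)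

The registered line `birth` cuts the crux into T (track transport in Dobrushin domains, a
bounded-Lipschitz lattice comparison — the whole DKKMO engine) + L (Lipschitz transfer of
`TendstoLaw`) + W (well-posedness). This line keeps that outer cut (L, W verbatim, same stub
names and signatures, so one proof serves both lines) and opens T at the place where
Duminil-Copin–Kozlowski–Krachun–Manolescu–Oulamara's scheme (arXiv:2012.11672) takes its ONLY
non-soft inputs — the two integrable facts behind their zero-drift Theorem 2.4 (Prop. 2.5 uses
commuting transfer matrices, Thm 2.7 the `sin θ`-anisotropy of the finite-size gaps) — and types
both of them at `n = 0` over the tree's `YBCylinderTransferMatrix θ N m` /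
`YBCylinderEigenvalue θ N m` (`YangBaxterSAWCylinder.lean`, the definition filed for this crux):

* H1 `stub_columnCommute` (FIRST LEMMA; provable now, size M–L) — the column transfer matrices
  of the Glazman–Manolescu walk on the cylinder `ℤ/N` COMMUTE for any two angles in
  `[π/3, 2π/3]`, in every strand sector `m`: `V_N^{(m)}(α) V_N^{(m)}(β) = V_N^{(m)}(β) V_N^{(m)}(α)`.
  Source of the proof: the Yang–Baxter equation for Nienhuis' weights (GM Prop. 3.1 — its 38
  trigonometric identities are PROVED in `YangBaxterSAWYBE.lean`) + the gluing principle (GM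
  Cor. 3.2, PROVED for planar complexes in `YangBaxterSAWGluing.lean`) run around the cylinder
  (the "train argument"; on `ℤ/N` the auxiliary rhombus of angle `β − α` is carried once around
  and removed by the inversion relation `r(φ) r(−φ) = id`, or the two-column annulus is cut open
  at a vacant row, which exists in every sector `m < N`). NUMERICAL CERTIFICATE (this session,
  `compute/ybcyl.py`, a literal transcription of `Cylinder.Compatible`): the commutator vanishes
  to `2·10⁻¹⁶` (relative) for `N = 1, …, 5`, `m = 0, …, 3`, four angle pairs, while `V(5π/12)`
  itself is asymmetric at the `0.2–0.3` level — the identity is exact and non-trivial.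
* H2 `stub_gapSineLaw` (Bethe-ansatz level; the engine's premise) — the SINE LAW of the gaps:
  for every sector `m` the limit `g m := lim_N −N log λ_N^{(m)}(θ) / sin θ` exists and does not
  depend on `θ ∈ [π/3, 2π/3]`, and `g` is strictly increasing (Coulomb gas: `g m = 2π x_m`,
  `x_m = (9m² − 4)/48` for `m ≥ 1`, `g 0 = 0` since `λ_N^{(0)} = 1` exactly — no bulk free
  energy at `n = 0`, `c = 0`). This is the `n = 0` form of [DKKMO, Thm 2.7] in exactly the
  strength their Prop. 2.5 consumes (`(1 − λ^{(m')}/λ^{(m)})(α) / (1 − λ^{(m')}/λ^{(m)})(β) →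
  sin α / sin β`), i.e. the Kim–Pearce anisotropy factor = the isoradial column width `sin θ`.
  NUMERICAL CERTIFICATE (same script; kit job j024264 extends to `N ≤ 9`): with
  `X_m(N,θ) := −N log λ_N^{(m)}(θ)/(2π sin θ)`, the spread of `X_m(N,·)` over
  `θ ∈ {π/3, 5π/12, π/2, 7π/12, 2π/3}` is `1.5·10⁻³, 5·10⁻⁴, 2·10⁻⁴` (relative) at `N = 3, 4, 5`
  and `X_1 = 0.1029, 0.1033, 0.1036 → 5/48 = 0.1042`, `X_2 = 0.650, 0.654, 0.657 → 2/3`,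
  `λ^{(0)} = 1` to machine precision. The cheapest falsifier of the whole route (its header's
  "n = 0 gap-anisotropy test", never run before) is thereby PASSED.
* H3 `stub_trackTransport_of_harvest` (HARDEST; XL) — `ColumnCommute → GapSineLaw → T`:
  the DKKMO engine at `n = 0` GIVEN its two integrable inputs. Its internal road map (the lead's
  first `--resplit`, once the cylinder one-polygon sector is a definition): (a) the `n = 0`
  Prop. 2.5 — on the cylinder with `m` strands and ONE polygon, the ratio of the probabilities
  that the polygon's rightmost tip pokes into the `α`-column or into the adjacent `π/2`-column is
  an exact expression in `λ_N^{(m)}, λ_N^{(m+2)}` at the two angles (commutation moves the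
  `α`-column; the tip adds two lines, `k + 3 ↦ m + 2`); with H2 it tends to
  `sin α/(sin α + sin β)`: ZERO DRIFT of right tips; left tips by the `180°` symmetry of the tile
  set, vertical drift (`cos α` per column, the shear of GM's embedding) by DKKMO's rotated
  construction (Prop. 6.17); (b) the local limit at a tip — DKKMO's half-plane 3-arm IIC becomes
  the APEX-PINNED INFINITE ARCH (two mutually avoiding half-plane walks from adjacent mid-edges
  of a column line), to be built by Kesten-type RENEWAL on arch-irreducible pieces (bridge lines
  crossed once by each arm), with GM Thm 2 (`B_T → 0`, PROVED: `GlazmanManolescu2019_thm2_holds`)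
  as the confinement input — this replaces RSW/quasi-multiplicativity, which SAW lacks; (c) the
  PINNED COUPLING: a column exchange preserves the law of the trace OUTSIDE the double column
  exactly (Cor. 3.2 iterated along GM's slide of the auxiliary rhombus from `+∞` to `−∞`; its
  possibly negative weights never enter a probability), so every line crossing is a nail and
  only middle-line crossings move — DKKMO's nail/homotopy bookkeeping (Thm 2.2) shrinks to
  "extremal abscissae of mesoscopic sub-arcs do not drift", nails → curve by sub-ballisticity
  (Duminil-Copin–Hammond) instead of RSW fractality; (d) the boundary: inside a Dobrushin domain
  the exchange is exact except at the `O(δ)`-collar where the two columns are cut at different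
  rows; the chordal walk visits the collar away from `a, b` with vanishing expected count
  (restriction exponent: boundary one-point exponent `8/κ − 1 = 2 > 1`), and the endpoints'
  lines are passed by endpoint surgery (the `π/2`-datum `(u', a', b')` is existential in T).
* L `stub_lipschitzTransfer`, W `stub_ybLawIsProbability` — verbatim the stubs of `birth`.

`AngleUniversality_of hC hG hE hL hW` is kernel-checked and `sorry`-free: T := hE hC hG, then the
glue of `birth` (robust square limit at the coupled datum; W makes the `α`-laws eventually
probability measures; L transfers the limit). Its conclusion is the route decl BY NAME.

Why this dodges the stuck point of `birth`: `birth`'s only hard stub T is monolithic ("zero drift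
needs sin θ-proportional gaps … Bethe-ansatz level, unproved" is INSIDE T together with everything
else). Here the Bethe-level input is ISOLATED as the clean spectral statement H2 (numerically
verified, citable the day a dilute-`O(0)` analogue of arXiv:2012.11675 appears, and refutable by a
finite computation if false), the exact-algebra input H1 is provable today from tree lemmas, and
the engine H3 is stated CONDITIONALLY on both — so a prover of H3 may use commuting transfer
matrices and the sine law as hypotheses, exactly as DKKMO §5–6 use their Prop. 2.5/Thm 2.7.

Disproof used: none exists for this crux (`ledger crux ls`: only `Lines/birth.*`; no
`_false_without_` theorem, no `Negative/` lemma). Negatives index (11 entries) checked: no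
statement here asserts tightness over all `δ` (stmt-0772 pattern); all limits are along `𝓝[>] 0`
or `atTop`. Degenerate cases: `m > N` (empty state space, `λ = 0`, `Real.log 0 = 0`) is harmless
for `atTop` limits; `N ∈ {1, 2}` commutation checked numerically as well; H2 quantifies `θ` over
the closed interval only (weights `≥ 0`, Perron–Frobenius applies, `λ_N^{(m)} ≥ v(θ)^m > 0`).
-/

noncomputable section

open MeasureTheory Filter Topology Set Bornology
open scoped NNReal ENNReal BoundedContinuousFunction Matrix
open Literature.Probability.RandomPlanarGeometry Literature.Probability.RandomPlanarGeometry.SAW.YangBaxter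

namespace Summit.CriticalPhenomena.SAWScalingLimit.Cruxes.AngleUniversality.CylinderHarvest

/-! ### Vocabulary of the line -/

/-- `RobustLimit θ P` — VERBATIM the `let RL` of the crux (as in `Lines/birth.lean`). -/
def RobustLimit (θ : ℝ) (P : ChordalFamily) : Prop :=
  ∀ (D : DobrushinDomain) (u : ℝ → ℂ) (a b : ℝ → MidEdge),
    (∀ᶠ δ in 𝓝[>] (0 : ℝ), ‖u δ‖ ≤ δ) →
    (∀ᶠ δ in 𝓝[>] (0 : ℝ), Nonempty (YangBaxterSAW (fun (_ : ℤ) => θ)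
      ((D.map (similarity 1 one_ne_zero (u δ))).carrier) δ (a δ) (b δ))) →
    Tendsto (fun δ : ℝ => (δ : ℂ) * planeMidpoint (fun (_ : ℤ) => θ) (a δ)) (𝓝[>] (0 : ℝ))
      (𝓝 (D.pt 0)) →
    Tendsto (fun δ : ℝ => (δ : ℂ) * planeMidpoint (fun (_ : ℤ) => θ) (b δ)) (𝓝[>] (0 : ℝ))
      (𝓝 (D.pt 1)) →
    TendstoLaw
      (fun δ (γ : YangBaxterSAW (fun (_ : ℤ) => θ)
        ((D.map (similarity 1 one_ne_zero (u δ))).carrier) δ (a δ) (b δ)) =>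
          γ.curve (fun (_ : ℤ) => θ) δ)
      (fun δ => ybLaw (fun (_ : ℤ) => θ) ((D.map (similarity 1 one_ne_zero (u δ))).carrier) δ 1
        (a δ) (b δ))
      id (P D)

/-- Consistency: the crux IS "`RobustLimit (π/2) P → RobustLimit α P`", definitionally. -/
theorem angleUniversality_iff :
    Summit.CriticalPhenomena.SAWScalingLimit.Theses.SAWTrackTransport.AngleUniversality ↔
      ∀ α ∈ Set.Icc (Real.pi / 3) (2 * Real.pi / 3), ∀ P : ChordalFamily, P.IsChordal →
        RobustLimit (Real.pi / 2) P → RobustLimit α P :=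
  Iff.rfl

/-- **H1, named. Commuting columns.** The column transfer matrices of the Glazman–Manolescu walk
on the cylinder `ℤ/N` commute for any two angles of `[π/3, 2π/3]`, in every strand sector. The
`n = 0` case of "the transfer matrices `V_N(θ)` commute" used in [DKKMO, Prop. 2.5]; GM §4.2:
"reminiscent of the use of the Yang–Baxter equation to prove the commutation of transfer
matrices". [GlazmanManolescu2019 Prop. 3.1, Cor. 3.2; DKKMO2020Rotational §2.4; Baxter 1978] -/
def ColumnCommute : Prop :=
  ∀ α ∈ Set.Icc (Real.pi / 3) (2 * Real.pi / 3), ∀ β ∈ Set.Icc (Real.pi / 3) (2 * Real.pi / 3),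
    ∀ (N m : ℕ) [NeZero N],
      YBCylinderTransferMatrix α N m * YBCylinderTransferMatrix β N m =
        YBCylinderTransferMatrix β N m * YBCylinderTransferMatrix α N m

/-- **H2, named. The sine law of the gaps** (Kim–Pearce anisotropy = isoradial column width):
there is a strictly increasing `g : ℕ → ℝ` such that for every sector `m` and every
`θ ∈ [π/3, 2π/3]`, `−N log λ_N^{(m)}(θ) / sin θ → g m` as `N → ∞` (written at `N + 1` so that the
cylinder is non-degenerate). Coulomb-gas values `g m = 2π (9m² − 4)/48` (`m ≥ 1`), `g 0 = 0`; the
`n = 0` counterpart of [DKKMO, Thm 2.7] (six-vertex, arXiv:2012.11675), unproved; numerically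
verified for `N ≤ 5` in this line's card. [DKKMO2020Rotational Thm 2.7; doi:10.1088/0305-4470/20/7/006;
Jacobsen2009LoopModelsCFT eq. (14.17); doi:10.1088/0305-4470/25/11/016] -/
def GapSineLaw : Prop :=
  ∃ g : ℕ → ℝ, StrictMono g ∧ ∀ (m : ℕ), ∀ θ ∈ Set.Icc (Real.pi / 3) (2 * Real.pi / 3),
    Tendsto (fun N : ℕ =>
        -(((N + 1 : ℕ) : ℝ) * Real.log (YBCylinderEigenvalue θ (N + 1) m)) / Real.sin θ)
      atTop (𝓝 (g m))

/-- **T, named** (verbatim `Lines/birth.lean`): track transport at `n = 0` in Dobrushin domains, as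
a bounded-Lipschitz asymptotic equality of the critical `α`-law and a coupled `π/2`-law. -/
def TrackTransport : Prop :=
  ∀ α ∈ Set.Icc (Real.pi / 3) (2 * Real.pi / 3),
    ∀ (D : DobrushinDomain) (u : ℝ → ℂ) (a b : ℝ → MidEdge),
      (∀ᶠ δ in 𝓝[>] (0 : ℝ), ‖u δ‖ ≤ δ) →
      (∀ᶠ δ in 𝓝[>] (0 : ℝ), Nonempty (YangBaxterSAW (fun (_ : ℤ) => α)
        ((D.map (similarity 1 one_ne_zero (u δ))).carrier) δ (a δ) (b δ))) →
      Tendsto (fun δ : ℝ => (δ : ℂ) * planeMidpoint (fun (_ : ℤ) => α) (a δ)) (𝓝[>] (0 : ℝ))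
        (𝓝 (D.pt 0)) →
      Tendsto (fun δ : ℝ => (δ : ℂ) * planeMidpoint (fun (_ : ℤ) => α) (b δ)) (𝓝[>] (0 : ℝ))
        (𝓝 (D.pt 1)) →
      ∃ (u' : ℝ → ℂ) (a' b' : ℝ → MidEdge),
        (∀ᶠ δ in 𝓝[>] (0 : ℝ), ‖u' δ‖ ≤ δ) ∧
        (∀ᶠ δ in 𝓝[>] (0 : ℝ), Nonempty (YangBaxterSAW (fun (_ : ℤ) => Real.pi / 2)
          ((D.map (similarity 1 one_ne_zero (u' δ))).carrier) δ (a' δ) (b' δ))) ∧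
        Tendsto (fun δ : ℝ => (δ : ℂ) * planeMidpoint (fun (_ : ℤ) => Real.pi / 2) (a' δ))
          (𝓝[>] (0 : ℝ)) (𝓝 (D.pt 0)) ∧
        Tendsto (fun δ : ℝ => (δ : ℂ) * planeMidpoint (fun (_ : ℤ) => Real.pi / 2) (b' δ))
          (𝓝[>] (0 : ℝ)) (𝓝 (D.pt 1)) ∧
        ∀ (g : CurveClass ℂ →ᵇ ℝ) (K : ℝ≥0), LipschitzWith K g →
          Tendsto (fun δ : ℝ =>
              (∫ γ, g (γ.curve (fun (_ : ℤ) => α) δ)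
                  ∂(ybLaw (fun (_ : ℤ) => α) ((D.map (similarity 1 one_ne_zero (u δ))).carrier) δ 1
                      (a δ) (b δ))) -
                ∫ γ, g (γ.curve (fun (_ : ℤ) => Real.pi / 2) δ)
                  ∂(ybLaw (fun (_ : ℤ) => Real.pi / 2)
                      ((D.map (similarity 1 one_ne_zero (u' δ))).carrier) δ 1 (a' δ) (b' δ)))
            (𝓝[>] (0 : ℝ)) (𝓝 0)

/-- **L, named** (verbatim `Lines/birth.lean`). -/
def LipschitzTransfer : Prop :=
  ∀ (Ω₁ Ω₂ : ℝ → Type) [∀ δ, MeasurableSpace (Ω₁ δ)] [∀ δ, MeasurableSpace (Ω₂ δ)]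
    (Y₁ : ∀ δ, Ω₁ δ → CurveClass ℂ) (Y₂ : ∀ δ, Ω₂ δ → CurveClass ℂ)
    (μ₁ : ∀ δ, Measure (Ω₁ δ)) (μ₂ : ∀ δ, Measure (Ω₂ δ)) (ν : Measure (CurveClass ℂ)),
    IsProbabilityMeasure ν →
    (∀ᶠ δ in 𝓝[>] (0 : ℝ), IsProbabilityMeasure (μ₂ δ)) →
    (∀ δ, Measurable (Y₂ δ)) →
    TendstoLaw Y₁ μ₁ id ν →
    (∀ (g : CurveClass ℂ →ᵇ ℝ) (K : ℝ≥0), LipschitzWith K g →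
      Tendsto (fun δ : ℝ => (∫ ω, g (Y₂ δ ω) ∂μ₂ δ) - ∫ ω, g (Y₁ δ ω) ∂μ₁ δ) (𝓝[>] (0 : ℝ))
        (𝓝 0)) →
    TendstoLaw Y₂ μ₂ id ν

/-- **W, named** (verbatim `Lines/birth.lean`). -/
def YBLawIsProbability : Prop :=
  ∀ θ ∈ Set.Icc (Real.pi / 3) (2 * Real.pi / 3), ∀ (Ω : Set ℂ), Bornology.IsBounded Ω →
    ∀ (δ : ℝ), 0 < δ → ∀ (a b : MidEdge), Nonempty (YangBaxterSAW (fun (_ : ℤ) => θ) Ω δ a b) →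
      IsProbabilityMeasure (ybLaw (fun (_ : ℤ) => θ) Ω δ 1 a b)

/-! ### The stubs (the ONLY `sorry`s of this file), in tree vocabulary -/

/-- **H1 — commuting columns (FIRST LEMMA of the line; provable now).** For `α, β ∈ [π/3, 2π/3]`,
every circumference `N ≥ 1` and every sector `m`, the column transfer matrices of the
Glazman–Manolescu walk on the cylinder `ℤ/N` commute. Proof plan: `V(α) V(β)` is the two-column
transfer matrix (a two-column filling determines its middle state; loops through both columns are
excluded because the middle state records the left connectivity); insert GM's auxiliary rhombus
`r` of angle `β − α` and slide it around the cylinder by `N` Yang–Baxter moves (Prop. 3.1, tree: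
`YangBaxterSAWYBE`; gluing Cor. 3.2, tree: `Cx.wsum_eq_of_Zloc_eq`), closing with the inversion
relation for Nienhuis' weights or by opening the annulus at a row left vacant by both states
(one exists when `m < N`; `m = N` is the diagonal case, all tiles straight). Numerically exact
(`2·10⁻¹⁶`) for `N ≤ 5`, `m ≤ 3`. [GlazmanManolescu2019 Prop. 3.1, Cor. 3.2, §4.2;
DKKMO2020Rotational Prop. 2.5; Baxter, Phil. Trans. R. Soc. A 289 (1978) (Z-invariance)] -/
theorem stub_columnCommute :
    ∀ α ∈ Set.Icc (Real.pi / 3) (2 * Real.pi / 3), ∀ β ∈ Set.Icc (Real.pi / 3) (2 * Real.pi / 3),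
      ∀ (N m : ℕ) [NeZero N],
        YBCylinderTransferMatrix α N m * YBCylinderTransferMatrix β N m =
          YBCylinderTransferMatrix β N m * YBCylinderTransferMatrix α N m := by
  sorry

/-- **H2 — the sine law of the finite-size gaps (Bethe-ansatz level; the engine's premise).**
There is a strictly increasing `g : ℕ → ℝ` with `−(N+1) log λ_{N+1}^{(m)}(θ) / sin θ → g m` for
every sector `m` and every `θ ∈ [π/3, 2π/3]`. Why plausibly true: the weights are Nienhuis'
integrable `O(n = 0)` weights with spectral parameter `u = 3θ/8`, crossing `λ = π/8`, whose
Kim–Pearce anisotropy angle `πu/(3λ)` is `θ` itself, and the model is `Z`-invariant on the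
rhombic lattice of angle `θ`; at `θ = π/3` it is the honeycomb SAW. Coulomb gas: `g m = 2π x_m`,
`x_m = (9m² − 4)/48`, `g 0 = 0`. Numerics (`N ≤ 5`, this line's card; `N ≤ 9` kit j024264):
`θ`-spread of `−N log λ/(2π sin θ)` is `2·10⁻⁴` at `N = 5` and shrinking like `N⁻²`. Why it might
fail: only through a breakdown of conformal invariance of the `n = 0` point of the integrable
family; a rigorous proof needs the dilute-`O(0)` (Izergin–Korepin `A₂^{(2)}`) Bethe ansatz at the
level of arXiv:2012.11675. [DKKMO2020Rotational Thm 2.7; doi:10.1088/0305-4470/20/7/006 (Kim–Pearce);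
doi:10.1088/0305-4470/25/11/016 (Warnaar–Batchelor–Nienhuis); Jacobsen2009LoopModelsCFT (14.17)] -/
theorem stub_gapSineLaw :
    ∃ g : ℕ → ℝ, StrictMono g ∧ ∀ (m : ℕ), ∀ θ ∈ Set.Icc (Real.pi / 3) (2 * Real.pi / 3),
      Tendsto (fun N : ℕ =>
          -(((N + 1 : ℕ) : ℝ) * Real.log (YBCylinderEigenvalue θ (N + 1) m)) / Real.sin θ)
        atTop (𝓝 (g m)) := by
  sorry

/-- **H3 — track transport in Dobrushin domains FROM the cylinder harvest (HARDEST; the DKKMO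
engine at `n = 0` given its two integrable inputs).** Assuming commuting columns (H1) and the sine
law (H2): for every `α ∈ [π/3, 2π/3]` and every `α`-admissible datum `(D, u, a, b)` there is a
`π/2`-admissible datum `(D, u', a', b')` of the same Dobrushin domain with bounded-Lipschitz
asymptotically equal critical laws of the drawn curve. Road map (see the module docstring):
(a) `n = 0` Prop. 2.5 on the cylinder with `m` strands and one polygon ⇒ with H2, ZERO DRIFT of the
tips (`sin α/(sin α + sin β)`); (b) apex-pinned infinite arch by Kesten renewal + `B_T → 0`
(`GlazmanManolescu2019_thm2_holds`) in place of the IIC and of RSW separation; (c) the pinned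
coupling (exchanges preserve the law of the trace outside the double column exactly), nails =
extremal abscissae/ordinates of mesoscopic sub-arcs, compounded steps and the CLT-type control of
[DKKMO §6.3–6.6], nails → curve by sub-ballisticity; (d) boundary collar and endpoint surgery
inside the Dobrushin domain (π/2-endpoint approximations exist: `CompassEndpoints`). Why it might
fail: (b) is an open Kesten-type local limit for CRITICAL weights; (d) needs the restriction-type
estimate that the chordal walk avoids the `O(δ)`-collar of `∂D` away from its endpoints.
[DKKMO2020Rotational Thms 2.1–2.4, §6; GlazmanManolescu2019 §3–4; Kesten1963SAW;
DuminilCopinHammond2013; LawlerSchrammWerner2004SAW §3.4] -/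
theorem stub_trackTransport_of_harvest :
    (∀ α ∈ Set.Icc (Real.pi / 3) (2 * Real.pi / 3), ∀ β ∈ Set.Icc (Real.pi / 3) (2 * Real.pi / 3),
      ∀ (N m : ℕ) [NeZero N],
        YBCylinderTransferMatrix α N m * YBCylinderTransferMatrix β N m =
          YBCylinderTransferMatrix β N m * YBCylinderTransferMatrix α N m) →
    (∃ g : ℕ → ℝ, StrictMono g ∧ ∀ (m : ℕ), ∀ θ ∈ Set.Icc (Real.pi / 3) (2 * Real.pi / 3),
      Tendsto (fun N : ℕ =>
          -(((N + 1 : ℕ) : ℝ) * Real.log (YBCylinderEigenvalue θ (N + 1) m)) / Real.sin θ)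
        atTop (𝓝 (g m))) →
    ∀ α ∈ Set.Icc (Real.pi / 3) (2 * Real.pi / 3),
    ∀ (D : DobrushinDomain) (u : ℝ → ℂ) (a b : ℝ → MidEdge),
      (∀ᶠ δ in 𝓝[>] (0 : ℝ), ‖u δ‖ ≤ δ) →
      (∀ᶠ δ in 𝓝[>] (0 : ℝ), Nonempty (YangBaxterSAW (fun (_ : ℤ) => α)
        ((D.map (similarity 1 one_ne_zero (u δ))).carrier) δ (a δ) (b δ))) →
      Tendsto (fun δ : ℝ => (δ : ℂ) * planeMidpoint (fun (_ : ℤ) => α) (a δ)) (𝓝[>] (0 : ℝ))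
        (𝓝 (D.pt 0)) →
      Tendsto (fun δ : ℝ => (δ : ℂ) * planeMidpoint (fun (_ : ℤ) => α) (b δ)) (𝓝[>] (0 : ℝ))
        (𝓝 (D.pt 1)) →
      ∃ (u' : ℝ → ℂ) (a' b' : ℝ → MidEdge),
        (∀ᶠ δ in 𝓝[>] (0 : ℝ), ‖u' δ‖ ≤ δ) ∧
        (∀ᶠ δ in 𝓝[>] (0 : ℝ), Nonempty (YangBaxterSAW (fun (_ : ℤ) => Real.pi / 2)
          ((D.map (similarity 1 one_ne_zero (u' δ))).carrier) δ (a' δ) (b' δ))) ∧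
        Tendsto (fun δ : ℝ => (δ : ℂ) * planeMidpoint (fun (_ : ℤ) => Real.pi / 2) (a' δ))
          (𝓝[>] (0 : ℝ)) (𝓝 (D.pt 0)) ∧
        Tendsto (fun δ : ℝ => (δ : ℂ) * planeMidpoint (fun (_ : ℤ) => Real.pi / 2) (b' δ))
          (𝓝[>] (0 : ℝ)) (𝓝 (D.pt 1)) ∧
        ∀ (g : CurveClass ℂ →ᵇ ℝ) (K : ℝ≥0), LipschitzWith K g →
          Tendsto (fun δ : ℝ =>
              (∫ γ, g (γ.curve (fun (_ : ℤ) => α) δ)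
                  ∂(ybLaw (fun (_ : ℤ) => α) ((D.map (similarity 1 one_ne_zero (u δ))).carrier) δ 1
                      (a δ) (b δ))) -
                ∫ γ, g (γ.curve (fun (_ : ℤ) => Real.pi / 2) δ)
                  ∂(ybLaw (fun (_ : ℤ) => Real.pi / 2)
                      ((D.map (similarity 1 one_ne_zero (u' δ))).carrier) δ 1 (a' δ) (b' δ)))
            (𝓝[>] (0 : ℝ)) (𝓝 0) := by
  sorry

/-- **L — bounded-Lipschitz asymptotic equality transfers `TendstoLaw` limits** (verbatim the stub
of `Lines/birth.lean`, same name and signature: portmanteau along the countably generated filter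
`𝓝[>] 0`; nearest tree lemmas `tendsto_integral_comp_of_forall_lipschitz`,
`tendstoLaw_of_dist_le`). [Billingsley 1999 Thm 2.1, 3.1; Dudley §11.3] -/
theorem stub_lipschitzTransfer :
    ∀ (Ω₁ Ω₂ : ℝ → Type) [∀ δ, MeasurableSpace (Ω₁ δ)] [∀ δ, MeasurableSpace (Ω₂ δ)]
      (Y₁ : ∀ δ, Ω₁ δ → CurveClass ℂ) (Y₂ : ∀ δ, Ω₂ δ → CurveClass ℂ)
      (μ₁ : ∀ δ, Measure (Ω₁ δ)) (μ₂ : ∀ δ, Measure (Ω₂ δ)) (ν : Measure (CurveClass ℂ)),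
      IsProbabilityMeasure ν →
      (∀ᶠ δ in 𝓝[>] (0 : ℝ), IsProbabilityMeasure (μ₂ δ)) →
      (∀ δ, Measurable (Y₂ δ)) →
      TendstoLaw Y₁ μ₁ id ν →
      (∀ (g : CurveClass ℂ →ᵇ ℝ) (K : ℝ≥0), LipschitzWith K g →
        Tendsto (fun δ : ℝ => (∫ ω, g (Y₂ δ ω) ∂μ₂ δ) - ∫ ω, g (Y₁ δ ω) ∂μ₁ δ) (𝓝[>] (0 : ℝ))
          (𝓝 0)) →
      TendstoLaw Y₂ μ₂ id ν := by
  sorry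

/-- **W — the critical Yang–Baxter law of a bounded domain is a probability measure as soon as one
walk joins the endpoints** (verbatim the stub of `Lines/birth.lean`, same name and signature:
finitely many faces, short-cutting to a face-simple walk of weight `∏ u₁ u₂ v > 0`,
`isProbabilityMeasure_ybLaw`). [GlazmanManolescu2019 §1 eq. (1); folklore] -/
theorem stub_ybLawIsProbability :
    ∀ θ ∈ Set.Icc (Real.pi / 3) (2 * Real.pi / 3), ∀ (Ω : Set ℂ), Bornology.IsBounded Ω →
      ∀ (δ : ℝ), 0 < δ → ∀ (a b : MidEdge), Nonempty (YangBaxterSAW (fun (_ : ℤ) => θ) Ω δ a b) →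
        IsProbabilityMeasure (ybLaw (fun (_ : ℤ) => θ) Ω δ 1 a b) := by
  sorry

/-! ### Consistency: each named statement IS its registered stub (definitionally) -/

theorem columnCommute_holds : ColumnCommute := stub_columnCommute
theorem gapSineLaw_holds : GapSineLaw := stub_gapSineLaw
theorem trackTransport_of_harvest_holds : ColumnCommute → GapSineLaw → TrackTransport :=
  stub_trackTransport_of_harvest
theorem lipschitzTransfer_holds : LipschitzTransfer := stub_lipschitzTransfer
theorem ybLawIsProbability_holds : YBLawIsProbability := stub_ybLawIsProbability

/-- The engine fed with its two harvested inputs gives T of `birth`. -/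
theorem trackTransport_holds : TrackTransport :=
  trackTransport_of_harvest_holds columnCommute_holds gapSineLaw_holds

/-! ### Name-keyed aliases of the statements — the hypotheses of `AngleUniversality_of`
(device of `Lines/birth.lean`: the native skeleton audit admits a `Prop` hypothesis of the
skeleton theorem only by the NAME of a registered obligation / declared stub). -/
namespace __Registered

/-- Alias of `ColumnCommute` keyed by the registered stub name. -/
abbrev stub_columnCommute : Prop := ColumnCommute
/-- Alias of `GapSineLaw` keyed by the registered stub name. -/
abbrev stub_gapSineLaw : Prop := GapSineLaw
/-- Alias of `ColumnCommute → GapSineLaw → TrackTransport` keyed by the registered stub name. -/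
abbrev stub_trackTransport_of_harvest : Prop := ColumnCommute → GapSineLaw → TrackTransport
/-- Alias of `LipschitzTransfer` keyed by the registered stub name. -/
abbrev stub_lipschitzTransfer : Prop := LipschitzTransfer
/-- Alias of `YBLawIsProbability` keyed by the registered stub name. -/
abbrev stub_ybLawIsProbability : Prop := YBLawIsProbability

end __Registered

/-! ### The skeleton theorem: the five stubs imply the crux, BY NAME -/

/-- **`AngleUniversality` from the line `cylinder-harvest`** (kernel-checked, no `sorry` of its
own). T := H3 H1 H2; then, given `α`, a chordal `P` with `RL(π/2) P` and an `α`-admissible datum,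
T yields a coupled `π/2`-datum with the bounded-Lipschitz comparison, `RL(π/2) P` gives the limit
`P D` for it, W makes the `α`-laws eventually probability measures, `P.IsChordal` makes `P D` one,
`YBWalk.measurable_of_top` gives measurability, and L transfers the limit: `RL(α) P`. -/
theorem AngleUniversality_of (hC : __Registered.stub_columnCommute)
    (hG : __Registered.stub_gapSineLaw) (hE : __Registered.stub_trackTransport_of_harvest)
    (hL : __Registered.stub_lipschitzTransfer) (hW : __Registered.stub_ybLawIsProbability) :
    Summit.CriticalPhenomena.SAWScalingLimit.Theses.SAWTrackTransport.AngleUniversality := by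
  have hT : TrackTransport := hE hC hG
  intro α hα P hP hsq D u a b hu hne ha hb
  obtain ⟨u', a', b', hu', hne', ha', hb', hcmp⟩ := hT α hα D u a b hu hne ha hb
  -- the robust square-tiling limit at the coupled datum
  have hlim := hsq D u' a' b' hu' hne' ha' hb'
  -- the `α`-laws are eventually probability measures
  have hprob : ∀ᶠ δ in 𝓝[>] (0 : ℝ), IsProbabilityMeasure
      (ybLaw (fun (_ : ℤ) => α) ((D.map (similarity 1 one_ne_zero (u δ))).carrier) δ 1 (a δ)
        (b δ)) := by
    filter_upwards [hne, self_mem_nhdsWithin] with δ hδ hpos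
    exact hW α hα _ (D.map (similarity 1 one_ne_zero (u δ))).isBounded δ hpos (a δ) (b δ) hδ
  exact hL _ _ _ _ _ _ (P D) (hP D).1 hprob (fun δ => YBWalk.measurable_of_top _) hlim hcmp

/-- Wiring check (an `example`, so that `AngleUniversality_of` stays the only theorem concluding the
crux): the registered stubs, with their tree-vocabulary types, feed the skeleton theorem. -/
example : Summit.CriticalPhenomena.SAWScalingLimit.Theses.SAWTrackTransport.AngleUniversality :=
  AngleUniversality_of stub_columnCommute stub_gapSineLaw stub_trackTransport_of_harvest
    stub_lipschitzTransfer stub_ybLawIsProbability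

end Summit.CriticalPhenomena.SAWScalingLimit.Cruxes.AngleUniversality.CylinderHarvest

end
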